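import Summits.Ventures.HodgeRepro2.T5CyclotomicSevenDegreeOnePrime

/-!
# THE CENSUS OF THE UNRAMIFIED PLACES OF THE FIELD OF RECORD `ℚ(ζ₇)` OVER `ℚ(ζ₇)⁺`, BY THE ORDER OF `p` MODULO `7`

Tier-5 support N3 / §G-N4.2 (seat p3, gen 79). Files 256 / 258 / 264 treat the rational primes of order `6`, `3`, `2`
modulo `7` one class at a time. This file states the whole census uniformly, for every rational prime `p ≠ 7` and
EVERY place `v` of `ℚ(ζ₇)⁺` above `p`, with `o := orderOf (p mod 7) ∈ {1, 2, 3, 6}` (the inertia degree of `p` in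
`ℚ(ζ₇)`, Mathlib): `f(v/p) ∣ 3` (`ℚ(ζ₇)⁺/ℚ` is a Galois cubic, file 264), `f(w/v) ∣ 2` (the fundamental identity on
`ℚ(ζ₇)/ℚ(ζ₇)⁺`), `f(v/p) · f(w/v) = o` (the tower law), hence

* **`inertiaDeg_eq_gcd_three`** — `f(v/p) = gcd(o, 3)`; **`absNorm_eq_pow_gcd`** — `N(v) = p^{gcd(o, 3)}`;
* **`inertiaDeg_over_eq_gcd_two`** — `f(w/v) = gcd(o, 2)`; `ramificationIdx_over_eq_one`, `ramificationIdx_eq_one` —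
  `e(w/v) = e(v/p) = 1`;
* **`ncard_primesOver_eq_one_iff_even`** — `v` has ONE place of `ℚ(ζ₇)` above it iff `o` is even, TWO iff `o` is odd
  (`ncard_primesOver_eq_two_iff_odd`); **`exists_map_eq_iff_even`** — `v` STAYS PRIME in `ℚ(ζ₇)` iff `o` is even;
* **`exists_map_eq_iff_not_isSquare`** — `v` stays prime in `ℚ(ζ₇)` iff `p` is a quadratic NON-RESIDUE modulo `7`
  (Euler's criterion: `p` is a square mod `7` iff `p³ ≡ 1`, iff `o ∣ 3`, iff `o` is odd) — the classical criterion
  for `ℚ(ζ₇) = ℚ(ζ₇)⁺(√−7)`;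
* **`ncard_primesOver_int_mul_gcd`** — `#{v ∣ p} · gcd(o, 3) = 3`: three places of `ℚ(ζ₇)⁺` above `p` when `3 ∤ o`
  (`p ≡ ±1`), one when `3 ∣ o` (`p ≡ ±2, ±3`).

§8(d): uses an L-value-free non-vanishing device: NO.
-/

open NumberField NumberField.IsCMField IsDedekindDomain IsDedekindDomain.HeightOneSpectrum Module Polynomial
open Summit.Ventures.HodgeRepro2.T5RecordSatakeInert Summit.Ventures.HodgeRepro2.T5InertDegreeAdicCompletion
  Summit.Ventures.HodgeRepro2.T5FinitePlaceSplitIff Summit.Ventures.HodgeRepro2.T5InertGlobalPrime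
  Summit.Ventures.HodgeRepro2.T5FinitePlaceCM Summit.Ventures.HodgeRepro2.T5FinitePlaceNormIndex
  Summit.Ventures.HodgeRepro2.T5CMFieldSquareDatum Summit.Ventures.HodgeRepro2.T5NonSplitPlaceUnitaryGroup
  Summit.Ventures.HodgeRepro2.T5FinitePlaceLocalDegree Summit.Ventures.HodgeRepro2.T5RecordSatakeIntrinsic
  Summit.Ventures.HodgeRepro2.T5CyclotomicSevenInertThree Summit.Ventures.HodgeRepro2.T5CyclotomicSevenInertPrime
  Summit.Ventures.HodgeRepro2.T5CyclotomicSevenSplitTwo Summit.Ventures.HodgeRepro2.T5CyclotomicSevenSplitPrime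
  Summit.Ventures.HodgeRepro2.T5CyclotomicSevenDegreeOnePrime

namespace Summit.Ventures.HodgeRepro2.T5CyclotomicSevenPlaceCensus

section Arithmetic

/-- `7` is prime (as a `Fact`, for `ZMod 7`). -/
theorem fact_prime_seven : Fact (Nat.Prime 7) := ⟨by norm_num⟩

/-- The divisors of `6`. -/
theorem eq_one_or_two_or_three_or_six_of_dvd_six {o : ℕ} (h : o ∣ 6) : o = 1 ∨ o = 2 ∨ o = 3 ∨ o = 6 := by
  have hle : o ≤ 6 := Nat.le_of_dvd (by norm_num) h
  interval_cases o <;> omega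

/-- The order of a non-zero class modulo `7` divides `6` (Fermat). -/
theorem orderOf_dvd_six (a : ZMod 7) (ha : a ≠ 0) : orderOf a ∣ 6 := by
  haveI := fact_prime_seven
  exact orderOf_dvd_of_pow_eq_one (ZMod.pow_card_sub_one_eq_one ha)

/-- **Euler's criterion modulo `7`**: a non-zero class is a square iff its order is odd (`a³ = 1`). -/
theorem isSquare_iff_odd_orderOf (a : ZMod 7) (ha : a ≠ 0) : IsSquare a ↔ Odd (orderOf a) := by
  haveI := fact_prime_seven
  rw [ZMod.euler_criterion 7 ha, show (7 : ℕ) / 2 = 3 from rfl, ← orderOf_dvd_iff_pow_eq_one]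
  rcases eq_one_or_two_or_three_or_six_of_dvd_six (orderOf_dvd_six a ha) with h | h | h | h <;> rw [h] <;> decide

variable (p : ℕ) [hp : Fact p.Prime]

/-- A prime `p ≠ 7` is non-zero modulo `7`. -/
theorem natCast_ne_zero_zmod_seven (h7 : ¬ p ∣ 7) : (p : ZMod 7) ≠ 0 := by
  intro h
  rw [ZMod.natCast_eq_zero_iff] at h
  exact h7 ((Nat.prime_dvd_prime_iff_eq (by norm_num) hp.out).mp h ▸ dvd_refl 7)

/-- `gcd(o, 3) · gcd(o, 2) = o` for `o ∣ 6`. -/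
theorem gcd_three_mul_gcd_two_of_dvd_six {o : ℕ} (h : o ∣ 6) : Nat.gcd o 3 * Nat.gcd o 2 = o := by
  rcases eq_one_or_two_or_three_or_six_of_dvd_six h with h | h | h | h <;> rw [h] <;> decide

end Arithmetic

section Seven

variable (K : Type*) [Field K] [CharZero K] [IsCyclotomicExtension {7} ℚ K]
variable (p : ℕ) [hp : Fact p.Prime] (h7 : ¬ p ∣ 7)

section Above

variable (P : Ideal (𝓞 K)) [P.IsPrime] [P.LiesOver (Ideal.span {(p : ℤ)})]

include h7 in
/-- Every prime of `𝓞_{ℚ(ζ₇)}` above `p ≠ 7` has inertia degree `orderOf (p mod 7)` (Mathlib). -/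
theorem inertiaDeg_of_liesOver :
    haveI := numberField' K
    P.inertiaDeg ℤ = orderOf (p : ZMod 7) := by
  haveI := numberField' K
  exact IsCyclotomicExtension.Rat.inertiaDeg_eq_of_not_dvd (m := 7) p K P h7

include h7 in
/-- Every prime of `𝓞_{ℚ(ζ₇)}` above `p ≠ 7` is unramified over `ℤ` (Mathlib). -/
theorem ramificationIdx_of_liesOver :
    haveI := numberField' K
    P.ramificationIdx ℤ = 1 := by
  haveI := numberField' K
  exact IsCyclotomicExtension.Rat.ramificationIdx_eq_of_not_dvd (m := 7) p K P h7

end Above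

section Place

variable (v : HeightOneSpectrum (𝓞 (maximalRealSubfield K))) [hv : v.asIdeal.LiesOver (Ideal.span {(p : ℤ)})]
include hv
variable (w : HeightOneSpectrum (𝓞 K)) [hw : w.asIdeal.LiesOver v.asIdeal]
include hw

include h7 in
/-- **The tower law `f(v/p) · f(w/v) = f(w/p) = orderOf (p mod 7)`.** -/
theorem inertiaDeg_mul_eq_orderOf :
    haveI := numberField' K; haveI := isCMField' K
    v.asIdeal.inertiaDeg ℤ * w.asIdeal.inertiaDeg (𝓞 (maximalRealSubfield K)) = orderOf (p : ZMod 7) := by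
  haveI := numberField' K
  haveI := isCMField' K
  haveI := T5CyclotomicSevenDegreeOnePrime.liesOver_int K p v w
  have htower := Ideal.inertiaDeg_tower (R := ℤ) v.asIdeal w.asIdeal
  rw [inertiaDeg_of_liesOver K p h7 w.asIdeal] at htower
  exact htower.symm

include h7 in
/-- **`e(w/v) = 1`** (the tower law with `e(w/p) = 1`). -/
theorem ramificationIdx_over_eq_one :
    haveI := numberField' K; haveI := isCMField' K
    w.asIdeal.ramificationIdx (𝓞 (maximalRealSubfield K)) = 1 := by
  haveI := numberField' K
  haveI := isCMField' K
  haveI := T5CyclotomicSevenDegreeOnePrime.liesOver_int K p v w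
  have htower := Ideal.ramificationIdx_tower (R := ℤ) v.asIdeal w.asIdeal
  rw [ramificationIdx_of_liesOver K p h7 w.asIdeal] at htower
  exact Nat.eq_one_of_mul_eq_one_left htower.symm

include h7 in
/-- **`e(v/p) = 1`.** -/
theorem ramificationIdx_eq_one :
    haveI := numberField' K; haveI := isCMField' K
    v.asIdeal.ramificationIdx ℤ = 1 := by
  haveI := numberField' K
  haveI := isCMField' K
  haveI := T5CyclotomicSevenDegreeOnePrime.liesOver_int K p v w
  have htower := Ideal.ramificationIdx_tower (R := ℤ) v.asIdeal w.asIdeal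
  rw [ramificationIdx_of_liesOver K p h7 w.asIdeal] at htower
  exact Nat.eq_one_of_mul_eq_one_right htower.symm

omit hp hv in
/-- **`f(w/v) ∣ 2`** (the fundamental identity `#{w ∣ v} · e(w/v) · f(w/v) = 2` on `ℚ(ζ₇)/ℚ(ζ₇)⁺`). -/
theorem inertiaDeg_over_dvd_two :
    haveI := numberField' K; haveI := isCMField' K
    w.asIdeal.inertiaDeg (𝓞 (maximalRealSubfield K)) ∣ 2 := by
  haveI := numberField' K
  haveI := isCMField' K
  have h := ncard_primesOver_mul_eq_two K v
  rw [Ideal.inertiaDegIn_eq_inertiaDeg v.asIdeal w.asIdeal (K ≃ₐ[maximalRealSubfield K] K)] at h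
  exact ⟨(v.asIdeal.primesOver (𝓞 K)).ncard * v.asIdeal.ramificationIdxIn (𝓞 K), by rw [← h]; ring⟩

include h7 in
/-- **`f(v/p) = gcd(orderOf (p mod 7), 3)`**: `f(v/p) ∣ 3` (Galois cubic), `f(w/v) ∣ 2`, and
`f(v/p) · f(w/v) = orderOf (p mod 7)`. -/
theorem inertiaDeg_eq_gcd_three :
    haveI := numberField' K; haveI := isCMField' K
    v.asIdeal.inertiaDeg ℤ = Nat.gcd (orderOf (p : ZMod 7)) 3 := by
  haveI := numberField' K
  haveI := isCMField' K
  have ho := inertiaDeg_mul_eq_orderOf K p h7 v w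
  have ha := T5CyclotomicSevenDegreeOnePrime.inertiaDeg_dvd_three K p v
  have hb := inertiaDeg_over_dvd_two K v w
  rw [← ho]
  rcases (Nat.dvd_prime Nat.prime_three).mp ha with h | h <;>
    rcases (Nat.dvd_prime Nat.prime_two).mp hb with h' | h' <;> rw [h, h'] <;> decide

include h7 in
/-- **`f(w/v) = gcd(orderOf (p mod 7), 2)`.** -/
theorem inertiaDeg_over_eq_gcd_two :
    haveI := numberField' K; haveI := isCMField' K
    w.asIdeal.inertiaDeg (𝓞 (maximalRealSubfield K)) = Nat.gcd (orderOf (p : ZMod 7)) 2 := by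
  haveI := numberField' K
  haveI := isCMField' K
  have ho := inertiaDeg_mul_eq_orderOf K p h7 v w
  have ha := T5CyclotomicSevenDegreeOnePrime.inertiaDeg_dvd_three K p v
  have hb := inertiaDeg_over_dvd_two K v w
  rw [← ho]
  rcases (Nat.dvd_prime Nat.prime_three).mp ha with h | h <;>
    rcases (Nat.dvd_prime Nat.prime_two).mp hb with h' | h' <;> rw [h, h'] <;> decide

omit w hw in
include h7 in
/-- **`N(v) = p^{gcd(orderOf (p mod 7), 3)}`**: `N(v) = p` for `p ≡ ±1 (mod 7)`, `N(v) = p³` for `p ≡ ±2, ±3`. -/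
theorem absNorm_eq_pow_gcd :
    haveI := numberField' K; haveI := isCMField' K
    Ideal.absNorm v.asIdeal = p ^ Nat.gcd (orderOf (p : ZMod 7)) 3 := by
  haveI := numberField' K
  haveI := isCMField' K
  obtain ⟨⟨P, hP, hPo⟩⟩ := Ideal.nonempty_primesOver (S := 𝓞 K) v.asIdeal
  haveI := hP
  haveI := hPo
  have h := Ideal.absNorm_pow_inertiaDeg (Ideal.span {(p : ℤ)}) v.asIdeal
  rw [absNorm_span_natCast_int,
    inertiaDeg_eq_gcd_three K p h7 v ⟨P, hP, Ideal.ne_bot_of_liesOver_of_ne_bot v.ne_bot P⟩ (hw := hPo)] at h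
  exact h.symm

omit w hw in
include h7 in
/-- **`#{w ∣ v} · gcd(orderOf (p mod 7), 2) = 2`.** -/
theorem ncard_primesOver_mul_gcd_two :
    haveI := numberField' K; haveI := isCMField' K
    (v.asIdeal.primesOver (𝓞 K)).ncard * Nat.gcd (orderOf (p : ZMod 7)) 2 = 2 := by
  haveI := numberField' K
  haveI := isCMField' K
  obtain ⟨⟨P, hP, hPo⟩⟩ := Ideal.nonempty_primesOver (S := 𝓞 K) v.asIdeal
  haveI := hP
  haveI := hPo
  have h := ncard_primesOver_mul_eq_two K v
  rw [Ideal.ramificationIdxIn_eq_ramificationIdx v.asIdeal P (K ≃ₐ[maximalRealSubfield K] K),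
    Ideal.inertiaDegIn_eq_inertiaDeg v.asIdeal P (K ≃ₐ[maximalRealSubfield K] K),
    ramificationIdx_over_eq_one K p h7 v ⟨P, hP, Ideal.ne_bot_of_liesOver_of_ne_bot v.ne_bot P⟩ (hw := hPo),
    inertiaDeg_over_eq_gcd_two K p h7 v ⟨P, hP, Ideal.ne_bot_of_liesOver_of_ne_bot v.ne_bot P⟩ (hw := hPo),
    one_mul] at h
  exact h

omit w hw in
include h7 in
/-- **ONE place of `ℚ(ζ₇)` above `v` iff `orderOf (p mod 7)` is even** (`p ≡ 3, 5, 6 (mod 7)`). -/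
theorem ncard_primesOver_eq_one_iff_even :
    haveI := numberField' K; haveI := isCMField' K
    (v.asIdeal.primesOver (𝓞 K)).ncard = 1 ↔ Even (orderOf (p : ZMod 7)) := by
  haveI := numberField' K
  haveI := isCMField' K
  have h := ncard_primesOver_mul_gcd_two K p h7 v
  rcases eq_one_or_two_or_three_or_six_of_dvd_six
    (orderOf_dvd_six (p : ZMod 7) (natCast_ne_zero_zmod_seven p h7)) with ho | ho | ho | ho <;>
    rw [ho] at h ⊢ <;> rw [Nat.even_iff]
  · rw [show Nat.gcd 1 2 = 1 from rfl, mul_one] at h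
    omega
  · rw [show Nat.gcd 2 2 = 2 from rfl] at h
    omega
  · rw [show Nat.gcd 3 2 = 1 from rfl, mul_one] at h
    omega
  · rw [show Nat.gcd 6 2 = 2 from rfl] at h
    omega

omit w hw in
include h7 in
/-- **TWO places of `ℚ(ζ₇)` above `v` iff `orderOf (p mod 7)` is odd** (`p ≡ 1, 2, 4 (mod 7)`). -/
theorem ncard_primesOver_eq_two_iff_odd :
    haveI := numberField' K; haveI := isCMField' K
    (v.asIdeal.primesOver (𝓞 K)).ncard = 2 ↔ Odd (orderOf (p : ZMod 7)) := by
  haveI := numberField' K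
  haveI := isCMField' K
  have h := ncard_primesOver_mul_gcd_two K p h7 v
  rcases eq_one_or_two_or_three_or_six_of_dvd_six
    (orderOf_dvd_six (p : ZMod 7) (natCast_ne_zero_zmod_seven p h7)) with ho | ho | ho | ho <;>
    rw [ho] at h ⊢ <;> rw [Nat.odd_iff]
  · rw [show Nat.gcd 1 2 = 1 from rfl, mul_one] at h
    omega
  · rw [show Nat.gcd 2 2 = 2 from rfl] at h
    omega
  · rw [show Nat.gcd 3 2 = 1 from rfl, mul_one] at h
    omega
  · rw [show Nat.gcd 6 2 = 2 from rfl] at h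
    omega

omit w hw in
include h7 in
/-- **`v` STAYS PRIME in `ℚ(ζ₇)` (`v 𝓞_K = w` for some place `w`) iff `orderOf (p mod 7)` is even.** -/
theorem exists_map_eq_iff_even :
    haveI := numberField' K; haveI := isCMField' K
    (∃ w : HeightOneSpectrum (𝓞 K),
      Ideal.map (algebraMap (𝓞 (maximalRealSubfield K)) (𝓞 K)) v.asIdeal = w.asIdeal) ↔
      Even (orderOf (p : ZMod 7)) := by
  haveI := numberField' K
  haveI := isCMField' K
  rw [← ncard_primesOver_eq_one_iff_even K p h7 v]
  constructor
  · rintro ⟨w, hw⟩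
    have hle : v.asIdeal ≤ Ideal.comap (algebraMap (𝓞 (maximalRealSubfield K)) (𝓞 K)) w.asIdeal := by
      rw [← hw]
      exact Ideal.le_comap_map
    haveI : w.asIdeal.LiesOver v.asIdeal :=
      ⟨v.isMaximal.eq_of_le (Ideal.comap_ne_top _ w.isPrime.ne_top) hle⟩
    exact ncard_primesOver_eq_one_of_staysPrime K v w hw
  · intro h1
    obtain ⟨⟨P, hP, hPo⟩⟩ := Ideal.nonempty_primesOver (S := 𝓞 K) v.asIdeal
    haveI := hP
    haveI := hPo
    refine ⟨⟨P, hP, Ideal.ne_bot_of_liesOver_of_ne_bot v.ne_bot P⟩,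
      map_eq_of_ramificationIdx'_eq_one_of_ncard_primesOver_eq_one K v
        ⟨P, hP, Ideal.ne_bot_of_liesOver_of_ne_bot v.ne_bot P⟩ ?_ h1⟩
    rw [Ideal.ramificationIdx'_eq_ramificationIdx v.asIdeal P v.ne_bot]
    exact ramificationIdx_over_eq_one K p h7 v ⟨P, hP, Ideal.ne_bot_of_liesOver_of_ne_bot v.ne_bot P⟩ (hw := hPo)

omit w hw in
include h7 in
/-- **THE QUADRATIC-RESIDUE CRITERION: `v` stays prime in `ℚ(ζ₇)` iff `p` is a non-square modulo `7`**
(`p ≡ 3, 5, 6 (mod 7)`); `v` splits iff `p` is a square modulo `7` (`p ≡ 1, 2, 4`). -/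
theorem exists_map_eq_iff_not_isSquare :
    haveI := numberField' K; haveI := isCMField' K
    (∃ w : HeightOneSpectrum (𝓞 K),
      Ideal.map (algebraMap (𝓞 (maximalRealSubfield K)) (𝓞 K)) v.asIdeal = w.asIdeal) ↔
      ¬ IsSquare (p : ZMod 7) := by
  haveI := numberField' K
  haveI := isCMField' K
  rw [exists_map_eq_iff_even K p h7 v, isSquare_iff_odd_orderOf (p : ZMod 7) (natCast_ne_zero_zmod_seven p h7),
    Nat.not_odd_iff_even]

omit w hw in
include h7 in
/-- **`#{v ∣ p} · gcd(orderOf (p mod 7), 3) = 3`**: three places of `ℚ(ζ₇)⁺` above `p ≡ ±1 (mod 7)`, one above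
`p ≡ ±2, ±3 (mod 7)` (the Galois fundamental identity on the cubic `ℚ(ζ₇)⁺/ℚ` with `e(v/p) = 1`). -/
theorem ncard_primesOver_int_mul_gcd :
    haveI := numberField' K; haveI := isCMField' K
    ((Ideal.span {(p : ℤ)}).primesOver (𝓞 (maximalRealSubfield K))).ncard * Nat.gcd (orderOf (p : ZMod 7)) 3 = 3 := by
  haveI := numberField' K
  haveI := isCMField' K
  haveI := isGalois_maximalRealSubfield K
  haveI : (Ideal.span {(p : ℤ)}).IsPrime :=
    (Ideal.span_singleton_prime (Nat.cast_ne_zero.mpr hp.out.ne_zero)).mpr (Nat.prime_iff_prime_int.mp hp.out)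
  obtain ⟨⟨P, hP, hPo⟩⟩ := Ideal.nonempty_primesOver (S := 𝓞 K) v.asIdeal
  haveI := hP
  haveI := hPo
  have h := Ideal.ncard_primesOver_mul_ramificationIdxIn_mul_inertiaDegIn (Ideal.span {(p : ℤ)})
    (𝓞 (maximalRealSubfield K)) (maximalRealSubfield K ≃ₐ[ℚ] maximalRealSubfield K)
  rw [Ideal.inertiaDegIn_eq_inertiaDeg _ v.asIdeal (maximalRealSubfield K ≃ₐ[ℚ] maximalRealSubfield K),
    Ideal.ramificationIdxIn_eq_ramificationIdx _ v.asIdeal (maximalRealSubfield K ≃ₐ[ℚ] maximalRealSubfield K),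
    IsGaloisGroup.card_eq_finrank (maximalRealSubfield K ≃ₐ[ℚ] maximalRealSubfield K) ℚ (maximalRealSubfield K),
    finrank_rat_maximalRealSubfield_seven K,
    inertiaDeg_eq_gcd_three K p h7 v ⟨P, hP, Ideal.ne_bot_of_liesOver_of_ne_bot v.ne_bot P⟩ (hw := hPo),
    ramificationIdx_eq_one K p h7 v ⟨P, hP, Ideal.ne_bot_of_liesOver_of_ne_bot v.ne_bot P⟩ (hw := hPo),
    one_mul] at h
  exact h

end Place

end Seven

end Summit.Ventures.HodgeRepro2.T5CyclotomicSevenPlaceCensus
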